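import Summits.QuantumFields.YangMills.Theses.ReplicaVarianceTilt

/-!
# Assembly of route `ReplicaVarianceTilt` (rung R3 of LADDER-YM, leaf `T3YM3TorusStatement.YM3TorusSU2`; item stmt-QuantumFields-26135)

The route file's kernel-checked deciding theorem `closes` packaged as the proof of the route's `Assembly` item:
`HeightChiSqL → HistoryTailL → LeafOfChiSq → YM3TorusSU2` — the glue `LeafOfChiSq` applied to the two cruxes.
No summit and no Clay statement is proved here; the rung `YM3TorusSU2` itself (a RECORD rung) stays open behind the open cruxes
`HeightChiSqL` (stmt-QuantumFields-26133) and `HistoryTailL` (stmt-QuantumFields-19936) and the open glue `LeafOfChiSq` (stmt-QuantumFields-26134).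
Filed by the width seat `ym-line-sfw-p2-w2` gen 16 (route affinity: rung R3, crux `HistoryTailL` shared with its own line's blocker).
-/

namespace Summit.QuantumFields.YangMills.Theorems

open Summit.QuantumFields.YangMills.Theses.ReplicaVarianceTilt in
/-- The `Assembly` item of route `ReplicaVarianceTilt` holds: it is the route's deciding theorem `closes` read as an implication
(`hG hV hT`). Nothing about the mass gap. -/
theorem replicaVarianceTilt_assembly : Summit.QuantumFields.YangMills.Theses.ReplicaVarianceTilt.Assembly :=
  fun hV hT hG => closes hV hT hG

end Summit.QuantumFields.YangMills.Theorems
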